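import Mathlib.Analysis.Calculus.ContDiff.Basic
import Mathlib.Analysis.Complex.Basic
import Mathlib.Topology.Algebra.Support
import Mathlib.Topology.MetricSpace.Pseudo.Lemmas
import HarnessLib

/-!
# No singular part on a flat stretch: an order-`0` functional supported on a line is killed by
# the level test (crux `BoundaryClosureR`, stmt-CriticalPhenomena-14004, line
# `polygon-parity-squeeze`, sub-goal of the registered stub `polygonLocalIdentity`, step (c))

Abstract functional-analytic kernel of the LOCAL CONTINUUM IDENTITY `∫_P g ∂̄φ = -√3 n_k κ ∫ φ dμ`.
Let `ℓ(w) = Re((w - z)·conj n)` be the signed level of the line through `z` with normal `n`, and let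
`S` be a functional on continuous functions supported in the ball `B(z, R)` which is

* additive, and bounded by the sup norm (`‖S ψ‖ ≤ C ‖ψ‖_∞`, "order `0`"),
* zero on functions supported in the open side `{ℓ > 0}` and on functions supported in `{ℓ < 0}`.

Then `S (ℓ·ψ) = 0` for every admissible `ψ` (`noSingularPart_levelMul`): cut `ℓψ` off at distance
`1/j` from the line on both sides; the two outer pieces are killed by the support hypotheses and the
inner piece has sup norm `≤ (2/j)‖ψ‖_∞`.  If moreover `S` is homogeneous and kills the expanded level
tests `(n/2)·χ + ℓ·∂̄χ` (`= ∂̄(ℓχ)`) for smooth `χ`, then `S χ = 0` for every smooth `χ` supported in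
the ball (`noSingularPart_of_levelTest`), `n ≠ 0`.  In the application `S = η - g·1_P dA` is the
would-be singular part of the weak-* limit `η` of the normalised bulk functionals on a flat boundary
ball of the polygon `P`; the conclusion is `η(∂̄φ) = ∫_P g ∂̄φ`.

References: folklore (order-`0` distributions supported on a hypersurface are measures on it; a
measure killed by all `(n/2)χ` vanishes).  No definition is introduced.
-/

noncomputable section

open scoped Topology ComplexConjugate ContDiff
open Filter Set Metric

namespace Summit.CriticalPhenomena.SAWScalingLimit.Theorems.PolygonParitySqueeze.PolygonLocal

/-! ### 1. The two-sided cutoff -/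

/-- The piecewise linear ramp `ρ_j(t) = min 1 (max 0 (j t - 1))`: `0` for `t ≤ 1/j`, `1` for
`t ≥ 2/j`, values in `[0, 1]`, continuous. [folklore] -/
theorem ramp_continuous (j : ℝ) : Continuous fun t : ℝ => min 1 (max 0 (j * t - 1)) :=
  continuous_const.min (continuous_const.max ((continuous_const.mul continuous_id).sub continuous_const))

/-- `0 ≤ ρ_j ≤ 1`. [folklore] -/
theorem ramp_mem_Icc (j t : ℝ) : min 1 (max 0 (j * t - 1)) ∈ Icc (0 : ℝ) 1 :=
  ⟨le_min zero_le_one (le_max_left _ _), min_le_left _ _⟩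

/-- `ρ_j(t) = 0` for `t ≤ 1/j` (`j > 0`). [folklore] -/
theorem ramp_eq_zero {j t : ℝ} (hj : 0 < j) (ht : t ≤ 1 / j) : min 1 (max 0 (j * t - 1)) = 0 := by
  have h1 : j * t ≤ 1 := by
    calc j * t ≤ j * (1 / j) := mul_le_mul_of_nonneg_left ht hj.le
      _ = 1 := mul_one_div_cancel hj.ne'
  rw [max_eq_left (by linarith), min_eq_right zero_le_one]

/-- `ρ_j(t) = 1` for `2/j ≤ t` (`j > 0`). [folklore] -/
theorem ramp_eq_one {j t : ℝ} (hj : 0 < j) (ht : 2 / j ≤ t) : min 1 (max 0 (j * t - 1)) = 1 := by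
  have h1 : 2 ≤ j * t := by
    calc (2 : ℝ) = j * (2 / j) := by field_simp
      _ ≤ j * t := mul_le_mul_of_nonneg_left ht hj.le
  rw [min_eq_left]
  exact le_trans (by linarith) (le_max_right _ _)

/-- The signed level `ℓ(w) = Re((w - z)·conj n)` is continuous. [folklore] -/
theorem continuous_level (z n : ℂ) : Continuous fun w : ℂ => ((w - z) * conj n).re :=
  Complex.continuous_re.comp ((continuous_id.sub continuous_const).mul continuous_const)

/-- The closed support of a product of three continuous factors lies in the closed support of the
middle one. [folklore] -/
theorem tsupport_mul3_subset (a b c : ℂ → ℂ) :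
    tsupport (fun w => a w * b w * c w) ⊆ tsupport b :=
  (tsupport_mul_subset_left (f := fun w => a w * b w) (g := c)).trans
    (tsupport_mul_subset_right (f := a) (g := b))

/-- The closed support of a product lies in the closed support of the last factor. [folklore] -/
theorem tsupport_mul3_subset_right (a b c : ℂ → ℂ) :
    tsupport (fun w => a w * b w * c w) ⊆ tsupport c :=
  tsupport_mul_subset_right (f := fun w => a w * b w) (g := c)

/-- The cutoff `ρ_j ∘ ℓ` has closed support in the closed strip `{1/j ≤ ℓ}`. [folklore] -/
theorem tsupport_ramp_level_subset {z n : ℂ} {j : ℝ} (hj : 0 < j) :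
    tsupport (fun w : ℂ => ((min 1 (max 0 (j * ((w - z) * conj n).re - 1)) : ℝ) : ℂ)) ⊆
      {w : ℂ | 1 / j ≤ ((w - z) * conj n).re} := by
  refine closure_minimal (fun w hw => ?_) (isClosed_le continuous_const (continuous_level z n))
  rw [Function.mem_support] at hw
  by_contra hlt
  simp only [mem_setOf_eq, not_le] at hlt
  exact hw (by rw [ramp_eq_zero hj hlt.le, Complex.ofReal_zero])

/-! ### 2. The functional kills `ℓ·ψ` -/

/-- **An additive order-`0` functional supported on the line kills `ℓ·ψ`.**  `S` is additive on
continuous functions supported in `ball z R`, bounded by `C·‖ψ‖_∞` there, and vanishes on those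
supported in `{ℓ > 0}` or in `{ℓ < 0}`; then `S (ℓ ψ) = 0`. [folklore] -/
theorem noSingularPart_levelMul : ∀ (z n : ℂ) (R : ℝ) (S : (ℂ → ℂ) → ℂ), (∀ ψ₁ ψ₂ : ℂ → ℂ, Continuous ψ₁ → tsupport ψ₁ ⊆ Metric.ball z R → Continuous ψ₂ → tsupport ψ₂ ⊆ Metric.ball z R → S (ψ₁ + ψ₂) = S ψ₁ + S ψ₂) → (∃ C : ℝ, ∀ ψ : ℂ → ℂ, Continuous ψ → tsupport ψ ⊆ Metric.ball z R → ∀ M : ℝ, (∀ w, ‖ψ w‖ ≤ M) → ‖S ψ‖ ≤ C * M) → (∀ ψ : ℂ → ℂ, Continuous ψ → tsupport ψ ⊆ Metric.ball z R → tsupport ψ ⊆ {w : ℂ | 0 < ((w - z) * (starRingEnd ℂ) n).re} → S ψ = 0) → (∀ ψ : ℂ → ℂ, Continuous ψ → tsupport ψ ⊆ Metric.ball z R → tsupport ψ ⊆ {w : ℂ | ((w - z) * (starRingEnd ℂ) n).re < 0} → S ψ = 0) → ∀ ψ : ℂ → ℂ, Continuous ψ → HasCompactSupport ψ → tsupport ψ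 ⊆ Metric.ball z R → S (fun w => ((((w - z) * (starRingEnd ℂ) n).re : ℝ) : ℂ) * ψ w) = 0 := by
  intro z n R S hadd hbd hin hout ψ hψ hψc hψR
  obtain ⟨C, hC⟩ := hbd
  -- a sup bound for `ψ`
  obtain ⟨M, hM⟩ := (hψ.norm.bddAbove_range_of_hasCompactSupport hψc.norm)
  have hM' : ∀ w, ‖ψ w‖ ≤ M := fun w => hM ⟨w, rfl⟩
  have hM0 : 0 ≤ M := (norm_nonneg _).trans (hM' z)
  set ℓ : ℂ → ℝ := fun w => ((w - z) * conj n).re with hℓ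
  have hℓc : Continuous ℓ := continuous_level z n
  -- it suffices to bound `‖S (ℓψ)‖` by `C · (2/j) · M` for every `j > 0`
  have key : ∀ j : ℝ, 0 < j → ‖S (fun w => ((ℓ w : ℝ) : ℂ) * ψ w)‖ ≤ C * (2 / j * M) := by
    intro j hj
    have hj1 : 0 < 1 / j := by positivity
    have hj2 : 0 < 2 / j := by positivity
    -- the real ramps and the complex cutoffs
    set rp : ℂ → ℝ := fun w => min 1 (max 0 (j * ℓ w - 1)) with hrp
    set rm : ℂ → ℝ := fun w => min 1 (max 0 (j * (-ℓ w) - 1)) with hrm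
    set θp : ℂ → ℂ := fun w => ((rp w : ℝ) : ℂ) with hθp
    set θm : ℂ → ℂ := fun w => ((rm w : ℝ) : ℂ) with hθm
    have hrpc : Continuous rp := (ramp_continuous j).comp hℓc
    have hrmc : Continuous rm := (ramp_continuous j).comp hℓc.neg
    have hθpc : Continuous θp := Complex.continuous_ofReal.comp hrpc
    have hθmc : Continuous θm := Complex.continuous_ofReal.comp hrmc
    have hℓψc : Continuous fun w => ((ℓ w : ℝ) : ℂ) * ψ w :=
      (Complex.continuous_ofReal.comp hℓc).mul hψ
    -- values of the ramps
    have hrp0 : ∀ w, ℓ w ≤ 1 / j → rp w = 0 := fun w hw => ramp_eq_zero hj hw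
    have hrm0 : ∀ w, -ℓ w ≤ 1 / j → rm w = 0 := fun w hw => ramp_eq_zero hj hw
    have hrp1 : ∀ w, 2 / j ≤ ℓ w → rp w = 1 := fun w hw => ramp_eq_one hj hw
    have hrm1 : ∀ w, 2 / j ≤ -ℓ w → rm w = 1 := fun w hw => ramp_eq_one hj hw
    have hrpI : ∀ w, rp w ∈ Icc (0 : ℝ) 1 := fun w => ramp_mem_Icc j (ℓ w)
    have hrmI : ∀ w, rm w ∈ Icc (0 : ℝ) 1 := fun w => ramp_mem_Icc j (-ℓ w)
    -- the three pieces
    set fp : ℂ → ℂ := fun w => ((ℓ w : ℝ) : ℂ) * ψ w * θp w with hfp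
    set fm : ℂ → ℂ := fun w => ((ℓ w : ℝ) : ℂ) * ψ w * θm w with hfm
    set fr : ℂ → ℂ := fun w => ((ℓ w : ℝ) : ℂ) * ψ w * (1 - θp w - θm w) with hfr
    have hfpc : Continuous fp := hℓψc.mul hθpc
    have hfmc : Continuous fm := hℓψc.mul hθmc
    have hfrc : Continuous fr := hℓψc.mul ((continuous_const.sub hθpc).sub hθmc)
    have hfpR : tsupport fp ⊆ ball z R := (tsupport_mul3_subset _ _ _).trans hψR
    have hfmR : tsupport fm ⊆ ball z R := (tsupport_mul3_subset _ _ _).trans hψR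
    have hfrR : tsupport fr ⊆ ball z R := (tsupport_mul3_subset _ _ _).trans hψR
    -- the outer pieces are killed
    have hSp : S fp = 0 := by
      refine hin fp hfpc hfpR ((tsupport_mul3_subset_right _ _ _).trans ?_)
      refine (tsupport_ramp_level_subset (z := z) (n := n) hj).trans fun w hw => ?_
      simp only [mem_setOf_eq] at hw ⊢
      exact lt_of_lt_of_le hj1 hw
    have hSm : S fm = 0 := by
      refine hout fm hfmc hfmR ((tsupport_mul3_subset_right _ _ _).trans ?_)
      have h1 : tsupport θm ⊆ {w : ℂ | 1 / j ≤ -ℓ w} := by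
        refine closure_minimal (fun w hw => ?_) (isClosed_le continuous_const hℓc.neg)
        rw [Function.mem_support] at hw
        by_contra hlt
        simp only [mem_setOf_eq, not_le] at hlt
        exact hw (by show ((rm w : ℝ) : ℂ) = 0; rw [hrm0 w hlt.le, Complex.ofReal_zero])
      refine h1.trans fun w hw => ?_
      simp only [mem_setOf_eq] at hw ⊢
      simp only [hℓ] at hw
      linarith
    -- the inner piece is small
    have hSr : ‖S fr‖ ≤ C * (2 / j * M) := by
      refine hC fr hfrc hfrR _ fun w => ?_
      have hcut : (1 : ℂ) - θp w - θm w = (((1 - rp w - rm w : ℝ)) : ℂ) := by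
        simp only [hθp, hθm]; push_cast; ring
      have hnorm : ‖fr w‖ = |ℓ w| * ‖ψ w‖ * |1 - rp w - rm w| := by
        simp only [hfr]
        rw [hcut, norm_mul, norm_mul, Complex.norm_real, Complex.norm_real, Real.norm_eq_abs,
          Real.norm_eq_abs]
      rw [hnorm]
      by_cases hw : 2 / j ≤ |ℓ w|
      · -- far from the line the cutoffs add up to one
        have h0 : 1 - rp w - rm w = 0 := by
          rcases le_abs'.1 hw with h | h
          · rw [hrm1 w (by linarith), hrp0 w (by linarith)]; ring
          · rw [hrp1 w h, hrm0 w (by linarith)]; ring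
        rw [h0, abs_zero, mul_zero]
        positivity
      · push Not at hw
        have hθ1 : |1 - rp w - rm w| ≤ 1 := by
          have hp := hrpI w
          have hm := hrmI w
          rw [abs_le]
          by_cases hs : 0 ≤ ℓ w
          · rw [hrm0 w (by linarith)]
            constructor <;> linarith [hp.1, hp.2]
          · push Not at hs
            rw [hrp0 w (by linarith)]
            constructor <;> linarith [hm.1, hm.2]
        calc |ℓ w| * ‖ψ w‖ * |1 - rp w - rm w| ≤ 2 / j * M * 1 := by
              gcongr
              exact hM' w
          _ = 2 / j * M := mul_one _
    -- additivity
    have hsum : (fun w => ((ℓ w : ℝ) : ℂ) * ψ w) = fp + fm + fr := by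
      funext w
      simp only [Pi.add_apply, hfp, hfm, hfr]
      ring
    have hfpmc : Continuous (fp + fm) := hfpc.add hfmc
    have hfpmR : tsupport (fp + fm) ⊆ ball z R :=
      (tsupport_add fp fm).trans (union_subset hfpR hfmR)
    rw [hsum, hadd _ _ hfpmc hfpmR hfrc hfrR, hadd _ _ hfpc hfpR hfmc hfmR, hSp, hSm, zero_add, zero_add]
    exact hSr
  -- let `j → ∞`
  have hlim : Tendsto (fun j : ℝ => C * (2 / j * M)) atTop (𝓝 0) := by
    have h1 : Tendsto (fun j : ℝ => 2 / j) atTop (𝓝 0) := tendsto_const_nhds.div_atTop tendsto_id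
    simpa using (tendsto_const_nhds (x := C)).mul ((h1.mul (tendsto_const_nhds (x := M))))
  have hle : ‖S (fun w => ((ℓ w : ℝ) : ℂ) * ψ w)‖ ≤ 0 :=
    ge_of_tendsto hlim ((eventually_gt_atTop 0).mono fun j hj => key j hj)
  exact norm_le_zero_iff.1 hle

/-! ### 3. The functional kills every smooth test function -/

/-- **No singular part.**  If in addition `S` is homogeneous and kills the expanded level tests
`(n/2)·χ + ℓ·∂̄χ` (`= ∂̄(ℓχ)`) for all smooth `χ` supported in the ball (`n ≠ 0`; `∂̄χ` enters only as
SOME continuous function `χ'` with the same support bound), then `S χ = 0` for every smooth `χ`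
supported in the ball: `S((n/2)χ) = S((n/2)χ + ℓχ') - S(ℓχ') = 0`. [folklore] -/
theorem noSingularPart_of_levelTest : ∀ (z n : ℂ) (R : ℝ) (S : (ℂ → ℂ) → ℂ) (dbar : (ℂ → ℂ) → ℂ → ℂ), n ≠ 0 → (∀ ψ₁ ψ₂ : ℂ → ℂ, Continuous ψ₁ → tsupport ψ₁ ⊆ Metric.ball z R → Continuous ψ₂ → tsupport ψ₂ ⊆ Metric.ball z R → S (ψ₁ + ψ₂) = S ψ₁ + S ψ₂) → (∀ ψ : ℂ → ℂ, Continuous ψ → tsupport ψ ⊆ Metric.ball z R → ∀ c : ℂ, S (c • ψ) = c * S ψ) → (∃ C : ℝ, ∀ ψ : ℂ → ℂ, Continuous ψ → tsupport ψ ⊆ Metric.ball z R → ∀ M : ℝ, (∀ w, ‖ψ w‖ ≤ M) → ‖S ψ‖ ≤ C * M) → (∀ ψ : ℂ → ℂ, Continuous ψ → tsupport ψ ⊆ Metric.ball z R → tsupport ψ ⊆ {w : ℂ | 0 < ((w - z) * (starRingEnd ℂ) n).re} → S ψ = 0) → (∀ ψ : ℂ → ℂ, Continuous ψ → tsupport ψ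 ⊆ Metric.ball z R → tsupport ψ ⊆ {w : ℂ | ((w - z) * (starRingEnd ℂ) n).re < 0} → S ψ = 0) → (∀ χ : ℂ → ℂ, ContDiff ℝ ∞ χ → HasCompactSupport χ → tsupport χ ⊆ Metric.ball z R → Continuous (dbar χ) ∧ tsupport (dbar χ) ⊆ tsupport χ ∧ S (fun w => n / 2 * χ w + ((((w - z) * (starRingEnd ℂ) n).re : ℝ) : ℂ) * dbar χ w) = 0) → ∀ χ : ℂ → ℂ, ContDiff ℝ ∞ χ → HasCompactSupport χ → tsupport χ ⊆ Metric.ball z R → S χ = 0 := by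
  intro z n R S dbar hn hadd hsmul hbd hin hout htest χ hχ hχc hχR
  obtain ⟨hdc, hdsupp, hS0⟩ := htest χ hχ hχc hχR
  have hdR : tsupport (dbar χ) ⊆ ball z R := hdsupp.trans hχR
  have hdcs : HasCompactSupport (dbar χ) := hχc.mono' ((subset_tsupport _).trans hdsupp)
  -- `S (ℓ · ∂̄χ) = 0`
  have h1 : S (fun w => ((((w - z) * (starRingEnd ℂ) n).re : ℝ) : ℂ) * dbar χ w) = 0 :=
    noSingularPart_levelMul z n R S hadd hbd hin hout (dbar χ) hdc hdcs hdR
  -- additivity splits the level test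
  have hc1 : Continuous fun w => n / 2 * χ w := continuous_const.mul hχ.continuous
  have hR1 : tsupport (fun w => n / 2 * χ w) ⊆ ball z R :=
    (tsupport_mul_subset_right (f := fun _ => n / 2) (g := χ)).trans hχR
  have hc2 : Continuous fun w => ((((w - z) * (starRingEnd ℂ) n).re : ℝ) : ℂ) * dbar χ w :=
    (Complex.continuous_ofReal.comp (continuous_level z n)).mul hdc
  have hR2 : tsupport (fun w => ((((w - z) * (starRingEnd ℂ) n).re : ℝ) : ℂ) * dbar χ w) ⊆ ball z R :=
    (tsupport_mul_subset_right
      (f := fun w => ((((w - z) * (starRingEnd ℂ) n).re : ℝ) : ℂ)) (g := dbar χ)).trans hdR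
  have hsplit := hadd _ _ hc1 hR1 hc2 hR2
  have heq : ((fun w => n / 2 * χ w) + fun w => ((((w - z) * (starRingEnd ℂ) n).re : ℝ) : ℂ) * dbar χ w) =
      fun w => n / 2 * χ w + ((((w - z) * (starRingEnd ℂ) n).re : ℝ) : ℂ) * dbar χ w := rfl
  rw [heq, hS0, h1, add_zero] at hsplit
  -- homogeneity
  have h2 : S ((n / 2) • χ) = n / 2 * S χ := hsmul χ hχ.continuous hχR (n / 2)
  have heq2 : (n / 2) • χ = fun w => n / 2 * χ w := rfl
  rw [heq2, ← hsplit] at h2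
  have hn2 : n / 2 ≠ 0 := div_ne_zero hn two_ne_zero
  exact (mul_eq_zero.1 h2.symm).resolve_left hn2

end Summit.CriticalPhenomena.SAWScalingLimit.Theorems.PolygonParitySqueeze.PolygonLocal

end
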